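import Literature.AlgebraicGeometry.Resolution.RegularRestrictionLocal
import Literature.AlgebraicGeometry.Resolution.SymbolicPowersRsop
import HarnessLib

/-!
# The exceptional equation is a nonzerodivisor modulo every POWER of the transform of a regular subscheme through
# the regular centre (BGMW 2011 §4 Remark (3), any codimension — primary form)

Topic: `Literature/AlgebraicGeometry/Resolution`. Companion of `RegularRestrictionLocal.lean`, which proves, for
`X` regular locally Noetherian, `π : X′ → X` a blow-up along `C` with `V(C)` regular, `H ≤ C` with `V(H)` regular
and `H′ = (π^*H : 𝓘(D))` the transform of `V(H)` with exponent one (= the ideal of the strict transform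
`Bl_C V(H) ↪ X′`, BGMW §4 Remark (3) «restriction property»; tree `IsBlowup.ker_strictTransformHom_of_isRegular`),
that a local equation `t` of the exceptional divisor is a nonzerodivisor modulo `H′`. Here the same is PROVED modulo
every power: **`s·t ∈ H′^k ⇒ s ∈ H′^k`** — at a point over the centre the stalk `H′_{x′}` is generated by part
`(e_m)` of a regular system of parameters `(t₀, e, w)` of `𝒪_{X′,x′}` (the chart analysis of
`RegularRestrictionLocal.lean`, verbatim), and powers of such a prime are primary with `t₀` outside it (Matsumura,
Thm. 16.2 (ii): tree `mem_pow_span_image_rsop_of_mul_mem`, `SymbolicPowersRsop.lean`).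

* `IsRsopPart.mem_pow_span_range_comp_of_mul_mem` — for a part `z` of a regular system of parameters, a sub-family
  `z ∘ ι` and an index `i ∉ range ι`: `z_i·y ∈ (z ∘ ι)^k ⇒ y ∈ (z ∘ ι)^k`.
* `IsBlowup.mem_pow_stalkIdeal_controlledTransform_of_mul_mem` — STALK FORM: `(t) = 𝓘(D)_{x′}`, `x′` over the centre,
  `s·t ∈ H′_{x′}^k ⇒ s ∈ H′_{x′}^k`.
* `mem_pow_ideal_of_mul_mem_of_isRegular_subscheme` — AFFINE FORM: on an affine open `V ⊆ X′` with `𝓘(D)(V) = (g₀)`,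
  `s·g₀ ∈ H′(V)^k ⇒ s ∈ H′(V)^k`; `mem_pow_ideal_of_pow_mul_mem_of_isRegular_subscheme` — the same for `g₀^m`.

Use (campaign `res-hironaka`, Q-03-006 Lem. 3.14 existence thread, blow-up step): this is the hypothesis
«`θ(t)` is a non-zero-divisor modulo `𝒩₁^b`» of the ring-level chart law `ARExtension.colon_map_highModel_le`
(`Hironaka2017/Lib/HighModelTransform.lean`) and of the lift of an infinitesimal retraction to a blow-up chart
(universal property of `B[P̄/t̄] → 𝒪₁⧸𝒩₁^b`), for `𝒩₁ = ker Bl_C(i)` the ideal of the strict transform of a regular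
`Y′ ⊇ V(C)`. Everything here is PROVED; no definitions.

## Sources
* [BGMW 2011] §4 Remark (3) (restriction property); §3.6 Lemma 3.6.4 (4), (6) (arXiv:1206.3090, pp. 8, 11).
  [BierstoneGrigorievMilmanWlodarczyk2011]
* H. Matsumura, *Commutative Ring Theory* (1986), Thm. 16.2 (ii) (powers of an ideal generated by a quasi-regular
  sequence), Thm. 14.2. [Matsumura1987]
* The Stacks Project, Tags 0804, 0BIQ (affine blow-up algebra and its charts), via `BlowupChartRsop.lean`,
  `BlowupStalkCharts.lean`. [StacksProject]
-/

noncomputable section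

open CategoryTheory CategoryTheory.Limits AlgebraicGeometry TopologicalSpace IsLocalRing

namespace Literature.AlgebraicGeometry.Resolution

universe u

/-! ## Powers of a prime generated by part of a regular system of parameters are primary (sub-family form) -/

/-- For a part `z` of a regular system of parameters of a local ring, an injective re-indexing `ι` and an index
`i ∉ range ι`: if `z_i · y ∈ (z_{ι 1}, …, z_{ι m})^k` then `y ∈ (z_{ι 1}, …, z_{ι m})^k` (the powers of the prime
`(z ∘ ι)` are primary and `z_i` lies outside it; Matsumura Thm. 16.2 (ii) through a full regular system of
parameters extending `z`, `IsRsopPart.exists_rsop`). [cite: Matsumura1987, Thm. 16.2 (ii)] -/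
theorem IsRsopPart.mem_pow_span_range_comp_of_mul_mem {R : Type u} [CommRing R] [IsLocalRing R] {n : ℕ}
    {z : Fin n → R} (hz : IsRsopPart z) {m : ℕ} (ι : Fin m → Fin n) {i : Fin n}
    (hi : i ∉ Set.range ι) (k : ℕ) {y : R} (h : z i * y ∈ Ideal.span (Set.range (z ∘ ι)) ^ k) :
    y ∈ Ideal.span (Set.range (z ∘ ι)) ^ k := by
  classical
  haveI := hz.isRegularLocalRing
  obtain ⟨e, x, hd, hx, hxz⟩ := hz.exists_rsop
  -- `range (z ∘ ι) = x '' S` for the finset `S = castAdd e '' (range ι)`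
  set S : Finset (Fin (n + e)) := Finset.univ.image (Fin.castAdd e ∘ ι) with hS
  have hzS : Set.range (z ∘ ι) = x '' (S : Set (Fin (n + e))) := by
    ext r
    simp only [Set.mem_range, Function.comp_apply, hS, Finset.coe_image, Finset.coe_univ, Set.image_univ,
      Set.mem_image, exists_exists_eq_and]
    constructor
    · rintro ⟨j, rfl⟩
      exact ⟨j, hxz (ι j)⟩
    · rintro ⟨j, rfl⟩
      exact ⟨j, (hxz (ι j)).symm⟩
  have ha : z i ∉ Ideal.span (x '' (S : Set (Fin (n + e)))) := by
    rw [← hzS, Set.range_comp]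
    exact hz.not_mem_span_image hi
  rw [hzS] at h ⊢
  rw [← hxz i] at h ha
  exact mem_pow_span_image_rsop_of_mul_mem hd x hx S ha k h

section Local

variable {X X' : Scheme.{u}} [IsLocallyNoetherian X] {π : X' ⟶ X} {C H : X.IdealSheafData}

/-- **Stalk form, powers.** `X` locally Noetherian and regular, `π` a blow-up along `C` with `V(C)` regular, `H ≤ C`
with `V(H)` regular, `x'` over the centre, `(t) = 𝓘(D)_{x'}`, `H' = (π^*H : 𝓘(D))`: if `s t ∈ H'_{x'}^k` then
`s ∈ H'_{x'}^k`. (Chart analysis of `IsBlowup.mem_stalkIdeal_controlledTransform_of_mul_mem`: `H'_{x'} = (e_m)_m` with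
`(t₀, e, w)` part of a regular system of parameters, `(t) = (t₀)`; then Matsumura 16.2 (ii).)
[cite: BierstoneGrigorievMilmanWlodarczyk2011, §4 Remark (3) (restriction property)] [cite: Matsumura1987, Thm. 16.2 (ii)] -/
theorem IsBlowup.mem_pow_stalkIdeal_controlledTransform_of_mul_mem (hX : Scheme.IsRegular X) (hπ : IsBlowup π C)
    (hC : Scheme.IsRegular C.subscheme) (hHC : H ≤ C) (hH : Scheme.IsRegular H.subscheme) (x' : X')
    (hxC : π x' ∈ C.support) {s t : X'.presheaf.stalk x'} (ht : stalkIdeal (C.comap π) x' = Ideal.span {t})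
    (k : ℕ) (hst : s * t ∈ stalkIdeal (controlledTransform π C H 1) x' ^ k) :
    s ∈ stalkIdeal (controlledTransform π C H 1) x' ^ k := by
  classical
  haveI : IsProper π := hπ.isProper
  haveI : IsLocallyNoetherian X' := LocallyOfFiniteType.isLocallyNoetherian π
  haveI : IsRegularLocalRing (X.presheaf.stalk (π x')) := hX _
  -- nested generators `c = (h, g)` of `C_x ⊇ H_x`, part of a regular system of parameters `(c, w)`
  obtain ⟨a, b, c, hrsop, hCc, hHc⟩ := exists_isRsopPart_nested_span_range_eq_stalkIdeal hHC hH hC hxC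
  obtain ⟨e, xr, hd, hxr, hxc⟩ := hrsop.exists_rsop
  let w : Fin e → X.presheaf.stalk (π x') := fun k => xr (Fin.natAdd (a + b) k)
  have happ : Fin.append c w = xr := by
    ext l
    induction l using Fin.addCases with
    | left m => rw [Fin.append_left, hxc]
    | right k => rw [Fin.append_right]
  have hz : Ideal.span (Set.range (Fin.append c w)) = maximalIdeal _ := by rw [happ, hxr]
  -- the Rees chart through `x'`
  obtain ⟨j, 𝔴, χ, hχ, hloc, h𝔴⟩ := hπ.exists_reesChart_stalk x' c hCc
  letI := χ.toAlgebra
  haveI := hloc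
  let t₀ : X'.presheaf.stalk x' := χ (chartBase c j (c j))
  have hχc : ∀ l, (π.stalkMap x').hom (c l) = t₀ * χ (chartGen c j l) := by
    intro l
    rw [← hχ, ← map_mul]
    exact congrArg χ (reesChartBase_apply_eq_mul_chartGen c j l)
  -- `𝓘(D)_{x'} = (t₀)`
  have hCst : stalkIdeal (C.comap π) x' = Ideal.span {t₀} := by
    rw [stalkIdeal_comap_eq_map_stalkMap, ← hCc, Ideal.map_span]
    apply le_antisymm
    · rw [Ideal.span_le]
      rintro _ ⟨_, ⟨l, rfl⟩, rfl⟩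
      rw [SetLike.mem_coe, hχc l]
      exact Ideal.mul_mem_right _ _ (Ideal.mem_span_singleton_self _)
    · rw [Ideal.span_singleton_le_iff_mem]
      have h1 : (π.stalkMap x').hom (c j) = t₀ := (hχ (c j)).symm
      rw [← h1]
      exact Ideal.subset_span ⟨c j, ⟨j, rfl⟩, rfl⟩
  have ht₀ : t₀ ∈ nonZeroDivisors (X'.presheaf.stalk x') :=
    IsLocalization.nonZeroDivisors_le_comap 𝔴.asIdeal.primeCompl (X'.presheaf.stalk x')
      (reesChartBase_mem_nonZeroDivisors (c j) (Ideal.mem_span_range_self (f := c) (x := j)))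
  -- `H'_{x'} = (ε_m : m < a)`, `ε_m = e_{castAdd b m}`
  let ε : Fin a → X'.presheaf.stalk x' := fun m => χ (chartGen c j (Fin.castAdd b m))
  have hHmap : (stalkIdeal H (π x')).map (π.stalkMap x').hom = Ideal.span {t₀} * Ideal.span (Set.range ε) := by
    rw [← hHc, Ideal.map_span, Ideal.span_mul_span', Set.singleton_mul]
    congr 1
    ext y
    constructor
    · rintro ⟨_, ⟨m, rfl⟩, rfl⟩
      exact ⟨ε m, ⟨m, rfl⟩, (hχc (Fin.castAdd b m)).symm⟩
    · rintro ⟨_, ⟨m, rfl⟩, rfl⟩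
      exact ⟨c (Fin.castAdd b m), ⟨m, rfl⟩, hχc (Fin.castAdd b m)⟩
  have hH'P : stalkIdeal (controlledTransform π C H 1) x' = Ideal.span (Set.range ε) := by
    rw [controlledTransform, pow_one, stalkIdeal_colon, stalkIdeal_comap_eq_map_stalkMap, hHmap, hCst,
      Submodule.colon_span]
    exact colon_span_singleton_mul_eq ht₀ _
  -- `t` and `t₀` generate the same ideal
  have htt₀ : t₀ ∈ Ideal.span {t} := by rw [← ht, hCst]; exact Ideal.mem_span_singleton_self _
  have ht₀t : t ∈ Ideal.span {t₀} := by rw [← hCst, ht]; exact Ideal.mem_span_singleton_self _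
  rw [hH'P] at hst ⊢
  -- if some `ε_m` is a unit, `H'_{x'} = (1)`
  by_cases hunit : ∀ m, ¬ IsUnit (ε m)
  swap
  · simp only [not_forall, not_not] at hunit
    obtain ⟨m, hm⟩ := hunit
    have : Ideal.span (Set.range ε) = ⊤ :=
      Ideal.eq_top_of_isUnit_mem _ (Ideal.subset_span ⟨m, rfl⟩) hm
    rw [this, Ideal.top_pow]; trivial
  -- otherwise all `e_{castAdd b m}` lie in `𝔴`, and `(t₀, ε)` is part of a regular system of parameters of `L`
  have hmem : ∀ m, chartGen c j (Fin.castAdd b m) ∈ 𝔴.asIdeal := by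
    intro m
    have h := hunit m
    rw [← IsLocalization.AtPrime.to_map_mem_maximal_iff (X'.presheaf.stalk x') 𝔴.asIdeal]
    exact (IsLocalRing.mem_maximalIdeal _).mpr h
  have hne : ∀ m, Fin.castAdd b m ≠ j := by
    intro m h
    apply hunit m
    change IsUnit (χ (chartGen c j (Fin.castAdd b m)))
    have h1 : chartGen c j j = 1 := chartGen_self c j
    rw [h, h1, map_one]
    exact isUnit_one
  let jJ : Fin a → {l : Fin (a + b) // l ≠ j} := fun m => ⟨Fin.castAdd b m, hne m⟩
  have hjJ : Function.Injective jJ := fun m m' h => by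
    have := congrArg Subtype.val h
    exact Fin.castAdd_injective _ _ this
  have hζ := isRsopPart_chartFamily_reesChart c j w hz (by exact_mod_cast hd) 𝔴.asIdeal h𝔴
    (X'.presheaf.stalk x') jJ hjJ (fun m => hmem m)
  let ι : Fin a → Fin (a + e + 1) := fun m => (Fin.castAdd e m).succ
  have hζι : chartFamily c j w (X'.presheaf.stalk x') (chartBase c j) (chartGen c j) jJ ∘ ι = ε := by
    funext m
    simp only [Function.comp_apply, ι, chartFamily, Fin.cons_succ, Fin.append_left]
    rfl
  have hζ0 : chartFamily c j w (X'.presheaf.stalk x') (chartBase c j) (chartGen c j) jJ 0 = t₀ := by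
    simp only [chartFamily, Fin.cons_zero]
    rfl
  have h0 : (0 : Fin (a + e + 1)) ∉ Set.range ι := by
    rintro ⟨m, hm⟩
    exact Fin.succ_ne_zero _ hm
  -- `t₀ · y ∈ (ε)^k ⇒ y ∈ (ε)^k` (Matsumura 16.2 (ii))
  have key : ∀ y, t₀ * y ∈ Ideal.span (Set.range ε) ^ k → y ∈ Ideal.span (Set.range ε) ^ k := by
    intro y hy
    have h := hζ.mem_pow_span_range_comp_of_mul_mem ι h0 k (y := y) (by rw [hζ0, hζι]; exact hy)
    rwa [hζι] at h
  -- `t = r' · t₀` with `r'` a unit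
  obtain ⟨r', hr'⟩ := Ideal.mem_span_singleton'.mp ht₀t
  obtain ⟨r, hr⟩ := Ideal.mem_span_singleton'.mp htt₀
  have hrr' : r * r' = 1 := by
    have h1 : (r * r') * t₀ = 1 * t₀ := by rw [mul_assoc, hr', hr, one_mul]
    exact (mul_cancel_right_mem_nonZeroDivisors ht₀).mp h1
  have hr'u : IsUnit r' := IsUnit.of_mul_eq_one_right r hrr'
  have h2 : t₀ * (s * r') ∈ Ideal.span (Set.range ε) ^ k := by
    have : t₀ * (s * r') = s * t := by rw [← hr']; ring
    rw [this]; exact hst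
  exact (Ideal.mul_unit_mem_iff_mem _ hr'u).mp (key _ h2)

/-- **Affine form, powers.** On an affine open `V ⊆ X'` with `𝓘(D)(V) = (g₀)`: `s g₀ ∈ H'(V)^k ⇒ s ∈ H'(V)^k`
(`X` regular locally Noetherian, `V(C)`, `V(H)` regular, `H ≤ C`, `H' = (π^*H : 𝓘(D))`). Checked at the stalks at
maximal ideals; off the centre `g₀` is a unit.
[cite: BierstoneGrigorievMilmanWlodarczyk2011, §4 Remark (3) (restriction property)] [cite: Matsumura1987, Thm. 16.2 (ii)] -/
theorem mem_pow_ideal_of_mul_mem_of_isRegular_subscheme (hX : Scheme.IsRegular X) (hπ : IsBlowup π C)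
    (hC : Scheme.IsRegular C.subscheme) (hHC : H ≤ C) (hH : Scheme.IsRegular H.subscheme)
    (V : X'.affineOpens) {g₀ : Γ(X', V)} (hDV : (C.comap π).ideal V = Ideal.span {g₀}) (k : ℕ)
    {s : Γ(X', V)} (hs : s * g₀ ∈ (controlledTransform π C H 1).ideal V ^ k) :
    s ∈ (controlledTransform π C H 1).ideal V ^ k := by
  haveI : IsProper π := hπ.isProper
  haveI : IsLocallyNoetherian X' := LocallyOfFiniteType.isLocallyNoetherian π
  -- work with the ideal sheaf `H'^k`
  have hpow : (controlledTransform π C H 1).ideal V ^ k = ((controlledTransform π C H 1) ^ k).ideal V := by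
    rw [Scheme.IdealSheafData.ideal_pow, Pi.pow_apply]
  rw [hpow] at hs ⊢
  refine Ideal.mem_of_localization_maximal fun P hP => ?_
  let p : PrimeSpectrum Γ(X', V) := ⟨P, hP.isPrime⟩
  have hy : V.2.fromSpec p ∈ (V : X'.Opens) := V.2.range_fromSpec.le ⟨p, rfl⟩
  letI alg : Algebra Γ(X', V) (X'.presheaf.stalk (V.2.fromSpec p)) :=
    (X'.presheaf.germ V _ hy).hom.toAlgebra
  haveI : IsLocalization.AtPrime (X'.presheaf.stalk (V.2.fromSpec p)) P :=
    V.2.isLocalization_stalk' p hy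
  -- it suffices to check `germ s ∈ (H'^k)_y`
  suffices hst : (X'.presheaf.germ V _ hy).hom s ∈ stalkIdeal ((controlledTransform π C H 1) ^ k)
      (V.2.fromSpec p) by
    let ε := (IsLocalization.algEquiv P.primeCompl (X'.presheaf.stalk (V.2.fromSpec p))
      (Localization.AtPrime P))
    have h1 : ((stalkIdeal ((controlledTransform π C H 1) ^ k) (V.2.fromSpec p)).map ε.toRingEquiv.toRingHom) =
        (((controlledTransform π C H 1) ^ k).ideal V).map (algebraMap _ (Localization.AtPrime P)) := by
      rw [stalkIdeal_eq_map_germ _ V hy, Ideal.map_map]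
      congr 1
      ext a
      exact ε.commutes a
    rw [← h1]
    have h2 : algebraMap Γ(X', V) (Localization.AtPrime P) s =
        ε.toRingEquiv.toRingHom ((X'.presheaf.germ V _ hy).hom s) := (ε.commutes s).symm
    rw [h2]
    exact Ideal.mem_map_of_mem _ hst
  -- the stalk of `𝓘(D)` at `y` is generated by `germ g₀`, and `germ s · germ g₀ ∈ (H'^k)_y = (H'_y)^k`
  have hDy : stalkIdeal (C.comap π) (V.2.fromSpec p) = Ideal.span {(X'.presheaf.germ V _ hy).hom g₀} := by
    rw [stalkIdeal_eq_map_germ _ V hy, hDV, Ideal.map_span, Set.image_singleton]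
  have hprod : (X'.presheaf.germ V _ hy).hom s * (X'.presheaf.germ V _ hy).hom g₀ ∈
      stalkIdeal ((controlledTransform π C H 1) ^ k) (V.2.fromSpec p) := by
    rw [← map_mul, stalkIdeal_eq_map_germ _ V hy]
    exact Ideal.mem_map_of_mem _ hs
  rw [stalkIdeal_pow] at hprod ⊢
  by_cases hyC : π (V.2.fromSpec p) ∈ C.support
  · exact hπ.mem_pow_stalkIdeal_controlledTransform_of_mul_mem hX hC hHC hH _ hyC hDy k hprod
  · -- off the centre `germ g₀` is a unit
    have hnot : V.2.fromSpec p ∉ ((C.comap π).support : Set X') := by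
      rw [Scheme.IdealSheafData.support_comap]
      exact hyC
    have htop : stalkIdeal (C.comap π) (V.2.fromSpec p) = ⊤ := stalkIdeal_eq_top_of_not_mem_support hnot
    rw [hDy, Ideal.span_singleton_eq_top] at htop
    exact (Ideal.mul_unit_mem_iff_mem _ htop).mp hprod

/-- **Affine form, powers of the equation**: `s g₀^m ∈ H'(V)^k ⇒ s ∈ H'(V)^k` (induction on `m`).
[cite: BierstoneGrigorievMilmanWlodarczyk2011, §4 Remark (3) (restriction property)] [cite: Matsumura1987, Thm. 16.2 (ii)] -/
theorem mem_pow_ideal_of_pow_mul_mem_of_isRegular_subscheme (hX : Scheme.IsRegular X) (hπ : IsBlowup π C)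
    (hC : Scheme.IsRegular C.subscheme) (hHC : H ≤ C) (hH : Scheme.IsRegular H.subscheme)
    (V : X'.affineOpens) {g₀ : Γ(X', V)} (hDV : (C.comap π).ideal V = Ideal.span {g₀}) (k m : ℕ)
    {s : Γ(X', V)} (hs : s * g₀ ^ m ∈ (controlledTransform π C H 1).ideal V ^ k) :
    s ∈ (controlledTransform π C H 1).ideal V ^ k := by
  induction m generalizing s with
  | zero => simpa using hs
  | succ m ih =>
    apply ih
    apply mem_pow_ideal_of_mul_mem_of_isRegular_subscheme hX hπ hC hHC hH V hDV k
    rw [mul_assoc, ← pow_succ]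
    exact hs

end Local

end Literature.AlgebraicGeometry.Resolution

end
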